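import Summits.QuantumFields.YangMills.Theorems.BalabanUVNodesN12GaugeLetterLocOfPlaqSmallLocal
import Literature.MathematicalPhysics.QuantumFieldTheory.Balaban1983to89.Node00.MultiScaleFibreChartB
import HarnessLib

/-!
# BalabanUVNodes ∕ N12 — THE FREE-`ε` (σ)_N EDITIONS WITH LOCAL DATUM ∕ SHADOW LETTERS: `N12GaugeLetterLocOfPlaqSmall` re-derived on the local capstone `N12GaugeLetterLocAtRecordLocal` — — **BOND-DATUM EDITION** (`…N12GaugeLetterLocOfPlaqSmallLocalB`, USED DECLARATIONS ONLY)

The print-datum ([Balaban1984PropagatorsII] (2.3)) (γ) twin of `Summits/…/Theorems/BalabanUVNodesN12GaugeLetterLocOfPlaqSmallLocal.lean`: the declarations of the parent whose STATEMENT reads the determining datum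
(`datumLetter_of_shadows_local`) and which N12's junction of record v14ᴸ uses (dag-n12-c g35 probe-2 census `UsedConstsN12RoadTyped2`, THEOREMS block), re-typed over a
BOND-LEVEL datum `𝔅 : BDetSet` (F0a `B15DeterminingSetsB`) and dag-n12-c's bond-datum chart `Node00.msChartB` (✓p774329; `msChart 𝐁 = msChartB (bondsDet 𝐁)` by `rfl`).  GENERATOR twin
(this seat's `work/g32/gen_thm.py`, block-extracted from the parent's tree bytes): namespace `…N12GaugeLetterLocOfPlaqSmallLocalB`, SAME short names, `DetSet ↦ BDetSet`, `AgreeOn 𝐁 ↦ AgreeOnB 𝔅`,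
`IsMinimizer ↦ IsMinimizerB`, `bondsOf (𝐁 j) ↦ 𝔅 j`, `msChart ∕ constrCard ∕ constrEnum ∕ ConstrSet ↦ …B`, NODE 00 chart lemmas `…msChart… ↦ …msChartB…`; proofs VERBATIM; the parent's
datum-free declarations REUSED BY NAME (`open`), never copied (private plumbing excepted, №366 R2).  The parent's (b) statements are the instances `𝔅 := bondsDet 𝐁`.

Cell `pub-ymgap` (HUMAN RULINGS D-0062 ∕ D-0149), seat `pub-ymgap-dag-n12-d` g32 (R134 N12 [B15] s2; the (ii) Theorems-side re-key of N12's road at print's [II] (2.3) datum — director-ym №338 ∕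
№343 (E1)(iii-b), FLAG №16 ∕ ruling (α); dag-n12-c DESIGN memo a793b2ebc0b803bf (ii); `N12-ROAD-TWIN-ORDER-2026-08-30.md`).  Count-neutral helper of K1⁹ `stmt-QuantumFields-27364`,
`--kind proof --supports … --as helper`.  THEOREMS ONLY (0 `def`, 0 `instance`, 0 `sorry`).

HONEST FRAMING (director-ym №338 (5)).  PURELY ADDITIVE: the parent stays landed and true on its own text; nothing in it is edited; no displayed premise of any consumer is deleted or
weakened; every hypothesis of the parent stays a hypothesis.  Nothing of Bałaban's analysis asserted; N12 NOT discharged; K0⁷ ∕ K1⁹ NOT closed; counts unmoved (typed 28∕28 · discharged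
8∕27, A 8∕28; K 1∕4); one finite 𝕋⁴ programme at fixed ε — R4 closes the conditional rung `BalabanLadder.UV` only; NOT the Yang–Mills mass gap (Clay); nothing continuum ∕ ℝ⁴ ∕ OS.

PARENT's DOCSTRING (the mathematics and the citations; read the site-level `𝐁` as the bond datum `𝔅`):
# BalabanUVNodes ∕ N12 — THE FREE-`ε` (σ)_N EDITIONS WITH LOCAL DATUM ∕ SHADOW LETTERS: `N12GaugeLetterLocOfPlaqSmall` re-derived on the local capstone `N12GaugeLetterLocAtRecordLocal` —
# the datum letter `hWj` and the shadow geometry `hGmem` are asked only for the members of `𝐁_k(Z)` within walk-distance `ℓ_k + m·L^k` of `Ω₁(Z)` (inhabitable from a bounded region box),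
# not for all of `bondsOf (Ω₁ᶜ)`

Cell `pub-ymgap` (HUMAN RULINGS D-0062 ∕ D-0149), WIDTH SEAT `pub-ymgap-dag-n12-w3` g4 (node N12 = [B15]; key K1⁹ `stmt-QuantumFields-27364` (KEY MAP v2), `--kind proof --supports … --as
helper`; count-neutral).  THEOREMS ONLY (0 `def`, 0 `instance`, 0 `sorry`); composition by name (honest flag of 2026-08-28: the global letters are uninhabitable far from `Z` when `W = ext Vk`).

★★ `datumLetter_of_shadows_local` (any `X`, `R`); ★★ `exists_gaugeLetterLoc_atRecord_of_supportSmall_local`; ★★★ `exists_gaugeLetterLoc_atRecord_of_plaqSmall_geometry_local` — RESIDUE: the minimiser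
`hmin`, the graded bound `hU` (free `ε > 0`, [Balaban1985Variational] Thm 1's output shape), the region datum `W 𝒞 ρn`, the region geometry `hGN` ∕ `hN1` (dag-n12-w6) and the LOCAL shadow
geometry `hGmem`, budgets `θ`, numerics.  The explicit corner (budgets chosen, numerics folded; class corollary) is the next file.

HONEST FRAMING.  Composition by name; every displayed letter stays a HYPOTHESIS; nothing of Bałaban's asserted beyond cited tree theorems; count-neutral; N12 NOT discharged; K1⁹ NOT closed;
counts unmoved (typed 28∕28 · discharged 5∕27); one finite 𝕋⁴ programme at fixed ε — R4 closes the conditional rung `BalabanLadder.UV` only; SCALING in `L` is the scale-0 one (crude); the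
Yang–Mills mass gap (Clay) is NOT proved by any of this; nothing continuum ∕ ℝ⁴ ∕ OS.
-/

noncomputable section

open scoped Matrix.Norms.L2Operator BigOperators

namespace Summit.QuantumFields.YangMills.BalabanUVNodes.N12GaugeLetterLocOfPlaqSmallLocalB

open Literature.MathematicalPhysics.QuantumFieldTheory.Balaban1983to89.B15DeterminingSetsB

open Literature.MathematicalPhysics.QuantumFieldTheory.Balaban1983to89
open T4Continuum GaugeField B15DeterminingSets BlockAveraging
open T4CubeChartGnomonic (SU2)
open B16Sect1Backgrounds (toMS)
open T4AxialGaugeSmallField (boxPlaqs castSite)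
open B14.Eq213MaximalDomains (side)
open B14.Eq213DetSet (Bj maxDomT maxDomT_antitone dist_maxDomT)
open B14.Eq216Concrete (inputs)
open B14.Eq22Determines (blockIter)
open B14DomainGeom (Within)
open B15Eq112TorusCover (cover lift cover_lift cover_apply)
open B5Eq118OneStroke (iterBlockOf)
open B7Prop1Explicit (e e_apply)
open B8Eq17ClassAkV1 (plaqsOf)
open ExpMeanLog (deltaSU)
open Literature.MathematicalPhysics.QuantumFieldTheory.BalabanImbrieJaffe1984to88.BIJ85Eq453GaugeField (qsstarGIter0)
open Summit.QuantumFields.YangMills.BalabanUVNodes.N20LCSAvgDominationRegion (boxRegion)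
open Summit.QuantumFields.YangMills.Theorems.BalabanUVNodesN11LocalIteratedAveraging (plaqSmallOn_iter_avOfRecord_of_boxClosed)
open Summit.QuantumFields.YangMills.BalabanUVNodes.N12BjCollarRoots (le_of_iterBlockOf_mem_Bj mem_maxDomT_of_iterBlockOf_mem_Bj)
open Summit.QuantumFields.YangMills.BalabanUVNodes.N12BjRootChainsGraded (exists_chain_centre_centre_graded)
open Summit.QuantumFields.YangMills.BalabanUVNodes.N12GaugeLetterLocAtRecordLocal (exists_gaugeLetterLoc_atRecord_local)
open Summit.QuantumFields.YangMills.BalabanUVNodes.N12GaugeLetterLocOfClass (exists_cover_of_mem_boxPlaqs boxPlaqs_src_mem_hullD)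
open B15Prop1MinimiserTowerAxialGauge (dist1_avgFamily_avOfRecord_qsstarGIter0_le)
open B15Prop1DatumSmall7AtZSequence (blockIter_add_embIter)
open Summit.QuantumFields.YangMills.BalabanUVNodes.N12GaugeLetterLocOfPlaqSmall (iteratedPlaqLetter_of_family_of_plaqSmall)
open Summit.QuantumFields.YangMills.BalabanUVNodes.N12SegmentPlaqFamilyAtRecord (exists_segmentPlaqFamily_Bj)

section
variable {P : Params}

/-- ★★ **THE LOCAL DATUM LETTER FROM THE LOCAL SHADOW GEOMETRY** — `N12DatumLetterOfShadows.datumLetter_of_shadows` with both sides restricted to the members `c` of `𝔅_i` one of whose segment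
ends `ι_i c∓` is reached from a point of `X` by a fine word of length `≤ R` (at the record: `X = Ω₁(Z)`, `R = ℓ_k + m·L^k`).
[cite: Balaban1988Convergent, (2.16) p.257, p.267 L5–7; Balaban1989LargeFieldI, p.193 L14–16; Balaban1987RG1, (0.1) p.251] -/
theorem datumLetter_of_shadows_local {F : T4Family} {N : ℕ} [NeZero N] (Kt : ℕ) {k : ℕ} (hk : k ≤ (F.P Kt).m + (F.P Kt).K) (𝔅 : BDetSet (F.P Kt))
    (W : GaugeField (F.P Kt) k (Node00.SU N)) {𝒞 : Set (PBond (F.P Kt) k)} {ρn : ℝ} (hρn : 0 ≤ ρn) (hD : ∀ c ∈ 𝒞, dist1 (W c) ≤ ρn)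
    (X : Set (Site (F.P Kt) 0)) (R : ℕ)
    (hGmem : ∀ x ∈ X, ∀ i ≤ k, ∀ c ∈ (𝔅 i),
      (∃ w : List (Letter (F.P Kt).d), w.length ≤ R ∧ (walkEnd x w = embIter i c.src ∨ walkEnd x w = embIter i c.tgt)) →
      blockIter k (embIter i c.tgt) ≠ blockIter k (embIter i c.src) → (⟨blockIter k (embIter i c.src), c.dir⟩ : PBond (F.P Kt) k) ∈ 𝒞) :
    ∀ x ∈ X, ∀ i ≤ k, ∀ c ∈ (𝔅 i),
      (∃ w : List (Letter (F.P Kt).d), w.length ≤ R ∧ (walkEnd x w = embIter i c.src ∨ walkEnd x w = embIter i c.tgt)) →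
      dist1 (avgFamily (Node00.avOfRecord F N Kt) (qsstarGIter0 k W) i c) ≤ ρn := by
  intro x hx i hi c hc hw
  obtain ⟨n, rfl⟩ := Nat.exists_eq_add_of_le hi
  have hG := hGmem x hx i hi c hc hw
  rw [blockIter_add_embIter i n hk c.tgt, blockIter_add_embIter i n hk c.src] at hG
  exact dist1_avgFamily_avOfRecord_qsstarGIter0_le Kt hk W hρn c fun hne => hD _ (hG hne)

end

end Summit.QuantumFields.YangMills.BalabanUVNodes.N12GaugeLetterLocOfPlaqSmallLocalB

end
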